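import Mathlib
import Summits.ResolutionOfSingularities.ResolutionOfSingularities.Theorems.WeightedInvariantLocalWeightedDropNCResBadDirCurve

/-!
# `WeightedInvariant.LocalWeightedDrop`: the TOT₂ line — REGIME (B) «letters in bad position» SETTLED

Crux item stmt-ResolutionOfSingularities-8899 `LocalWeightedDrop` (route `ResolutionOfSingularities/WeightedInvariant`), ENGINE skeleton v33
(res-L1-w43-lead-1 g5, TOT2-LINE v1.3 `L/res-L1-w43-lead-1/g5/TOT2-LINE-v1.3.md` §2), registered regime stub `stub_regimeBad` (deal → res-type-056,
res-L1-w43-plan-1 DEALS 15:29:06Z).  [OURS · L1 W4.3 · chain w43 · seat res-type-056; def-free; the count game is the programme's own; nothing here is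
a statement of any manuscript; AI-produced, gate-checked, weaker than expert review.]

WHAT.  `NCResBad.dWinsTo_exit_of_badDir`: three letters, `k` infinite; an admissibly decorated state with `o ≥ 2` in BAD POSITION (`O = ∅`, a
directrix form supported on boundary letters involving at least two of them) wins to «admissibly decorated, and: head drop, or same head in the apex
column (H) or in good position (P-good)»: by the POINT LOOP (…NCResBadDirPoint; support of size three, or size two with a failing level along the free
letter's axis) or, when the free letter's axis is permissible (`f ∈ (x_S)^o`), by the CURVE MOVE (…NCResBadDirCurve).  `NCResBad.regimeBad` is the
registered text of `stub_regimeBad` VERBATIM (binders `∀ p prime, ∀ k [Field k] [CharP k p] [IsAlgClosed k]`; its hypothesis `¬ HCol` is not used).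
-/

set_option linter.dupNamespace false -- mandated namespace of this single-conjunct summit

noncomputable section

namespace Summit.ResolutionOfSingularities.ResolutionOfSingularities.Theorems

namespace TameFourTupleDrop

namespace NCResBad

open MvPowerSeries Literature.AlgebraicGeometry.Resolution GraphCurve

variable {k : Type} [Field k]

/-- In three letters, a vector with at least two non-zero entries vanishes at most at one index. -/
theorem forall_ne_of_two_ne_zero {ℓ : Fin (2 + 1) → k} {j j₁ j₂ : Fin (2 + 1)} (hj : j₁ ≠ j₂) (hj₁ : ℓ j₁ ≠ 0) (hj₂ : ℓ j₂ ≠ 0)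
    (hj0 : ℓ j = 0) : ∀ l, l ≠ j → ℓ l ≠ 0 := by
  intro l hl
  have h1 : j ≠ j₁ := fun h => hj₁ (h ▸ hj0)
  have h2 : j ≠ j₂ := fun h => hj₂ (h ▸ hj0)
  by_cases hl1 : l = j₁
  · rw [hl1]; exact hj₁
  by_cases hl2 : l = j₂
  · rw [hl2]; exact hj₂
  exfalso
  have := Fin.val_injective.ne hj
  have := Fin.val_injective.ne h1
  have := Fin.val_injective.ne h2
  have := Fin.val_injective.ne hl
  have := Fin.val_injective.ne hl1
  have := Fin.val_injective.ne hl2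
  have := j.isLt
  have := j₁.isLt
  have := j₂.isLt
  have := l.isLt
  omega

/-- **REGIME (B) «LETTERS IN BAD POSITION» EXITS** (three letters, `k` infinite): from an admissibly decorated state with `o ≥ 2` in bad position
the director wins to «admissibly decorated, and: head drop, or same head with apex column or good position». -/
theorem dWinsTo_exit_of_badDir [Infinite k] {b : MvPowerSeries (Fin (2 + 1)) k} {δ : Decoration k 2} (hadm : Admissible b δ)
    (ho : 2 ≤ δ.o) (hbad : δ.BadDir) :
    DWinsTo (St := MvPowerSeries (Fin (2 + 1)) k × Decoration k 2) Prod.fst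
      (fun τ => Admissible τ.1 τ.2 ∧ (τ.2.head < δ.head ∨ (τ.2.head = δ.head ∧ (τ.2.HCol ∨ τ.2.GoodDir)))) (b, δ) := by
  classical
  obtain ⟨hO, ℓ, hℓ, hsupp, j₁, j₂, hj, hj₁, hj₂⟩ := hbad
  by_cases hfull : ∀ j, ℓ j ≠ 0
  · exact dWinsTo_exit_of_badDir_level hadm ho hO hℓ hsupp (Or.inl hfull)
  push Not at hfull
  obtain ⟨j, hj0⟩ := hfull
  have hne : ∀ l, l ≠ j → ℓ l ≠ 0 := forall_ne_of_two_ne_zero hj hj₁ hj₂ hj0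
  by_cases hin : InOffIdeal j δ.o δ.f
  · exact dWinsTo_exit_of_badDir_inOffIdeal hadm ho hO hℓ hj0 hne hin
  · obtain ⟨r, hr⟩ := exists_not_level_of_not_inOffIdeal hin
    exact dWinsTo_exit_of_badDir_level hadm ho hO hℓ hsupp (Or.inr ⟨j, hj0, hne, r, hr⟩)

/-- **THE REGISTERED TEXT OF `stub_regimeBad` (skeleton v33, TOT2-LINE v1.3 §2), VERBATIM** — by `dWinsTo_exit_of_badDir` (an algebraically closed
field is infinite; the hypothesis `¬ HCol` is not used). -/
theorem regimeBad : ∀ (p : ℕ), p.Prime → ∀ (k : Type) [Field k] [CharP k p] [IsAlgClosed k],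
    ∀ (b : MvPowerSeries (Fin 3) k) (δ : TameFourTupleDrop.Decoration k 2), TameFourTupleDrop.Admissible b δ → 2 ≤ δ.o → ¬ δ.HCol →
      δ.BadDir →
      TameFourTupleDrop.DWinsTo (St := MvPowerSeries (Fin 3) k × TameFourTupleDrop.Decoration k 2) Prod.fst
        (fun τ => TameFourTupleDrop.Admissible τ.1 τ.2 ∧ (τ.2.head < δ.head ∨ (τ.2.head = δ.head ∧ (τ.2.HCol ∨ τ.2.GoodDir)))) (b, δ) :=
  fun _ _ _ _ _ _ _ _ hadm ho _ hbad => dWinsTo_exit_of_badDir hadm ho hbad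

end NCResBad

end TameFourTupleDrop

end Summit.ResolutionOfSingularities.ResolutionOfSingularities.Theorems

end
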